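import Literature.AlgebraicGeometry.KTheory.PullbackVectorBundle
import Literature.AlgebraicGeometry.Modules.AffineLocalizingClosure
import Literature.AlgebraicGeometry.Modules.LocalFrames
import Literature.AlgebraicGeometry.Motives.DifferentialsLocallyFreeProofs
import Mathlib.RingTheory.Localization.Free
import Mathlib.RingTheory.LocalRing.Module
import Mathlib.RingTheory.Flat.Stability
import Mathlib.RingTheory.Localization.BaseChange
import Mathlib.RingTheory.TensorProduct.Free

/-!
# The kernel of an epimorphism of finite locally free modules is finite locally free (support for EB1)

Support lemma for stub EB1 (`stub_towerPresentation`) of line `chow-zariski-pushforward` of the crux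
`FormalVectorBundlesAlgebraize` (route `PadicSemiregularLift` of `HodgeConjecture`): on any scheme `X`,
if `φ : E ⟶ F` is an epimorphism of `𝒪_X`-modules between finite locally free modules then
`ker φ` is finite locally free (The Stacks Project, Tag 05P2 with 00NX: the kernel of a surjection of
finite projective modules is finite projective, and finite projective modules are locally free,
Tag 00NZ/00NX).

Proof: near a point `x`, `K = ker φ` is a retract of `E|_W ≅ 𝒪^I` (tree
`exists_isSplitMono_over_of_shortExact`), so `P = Γ(K, V)` is a finite projective module over
`B = Γ(X, V)` for a small affine open `V ∋ x` (`Module.Projective.of_split`; the sections of `E` over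
`V` are free on the basis sections of a frame, tree `LocalFrames`); hence `P_𝔭` is free at the prime
`𝔭` of `x` (Mathlib `Module.free_of_flat_of_isLocalRing`) and `P_r` is free for some `r ∉ 𝔭` (Mathlib
`Module.FinitePresentation.exists_basis_localizedModule_powers`); since `K` is affine-localizing
(kernel of quasi-coherent modules, tree `IsAffineLocalizing.kernel`), `Γ(K, D(r)) = P_r` is free over
`Γ(X, D(r)) = B_r`, and an affine-localizing module with free sections on an affine open `D` is free
on `D` (Mathlib's `~` construction: `isIso_fromTildeΓ_iff_isLocalizing`, `tildeFinsupp`, tree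
`nonempty_free_iso_over_of_free_iso_restrict`). Everything is proved; no definitions.
-/

noncomputable section

-- Summit.HodgeConjecture.HodgeConjecture.… repeats the summit name by the D-0017 layout (Sub = Summit).
set_option linter.dupNamespace false
-- `TopCat.Presheaf`/`TopCat.Sheaf` and `Scheme.Modules` are not reducible (as in Mathlib's
-- `AlgebraicGeometry/Modules/Tilde.lean` and the tree's `Motives/DifferentialsLocallyFreeProofs`).
set_option backward.isDefEq.respectTransparency false

open CategoryTheory CategoryTheory.Limits AlgebraicGeometry TopologicalSpace Opposite
open Literature.AlgebraicGeometry.Motives Literature.AlgebraicGeometry.Modules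
open Literature.AlgebraicGeometry.KTheory

universe u

namespace Summit.HodgeConjecture.HodgeConjecture.Theorems.FormalVectorBundlesAlgebraize

variable {X : Scheme.{u}}

/-! ### Sections of a framed module are free on the basis sections -/

section FrameBasis

variable {E : X.Modules} {W : X.Opens} {I : Type u} (e : SheafOfModules.free I ≅ E.over W)

/-- Coordinates are additive. -/
theorem coord_add (s t : Γ(E, W)) (i : I) :
    coord e (𝟙 W) (s + t) i = coord e (𝟙 W) s i + coord e (𝟙 W) t i := by
  rw [coord_def, coord_def, coord_def, appLE_add_right]

/-- Coordinates are `Γ(X, W)`-linear. -/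
theorem coord_smul (a : Γ(X, W)) (s : Γ(E, W)) (i : I) :
    coord e (𝟙 W) (a • s) i = a * coord e (𝟙 W) s i := by
  rw [coord_def, coord_def, appLE_smul_right]
  rfl

variable [Fintype I]

/-- **The basis sections of a frame `𝒪^I ≅ E|_W` form a basis of the `Γ(X, W)`-module `Γ(E, W)`.** -/
theorem nonempty_basis_of_frame (e : SheafOfModules.free I ≅ E.over W) :
    Nonempty (Module.Basis I Γ(X, W) Γ(E, W)) := by
  classical
  refine ⟨Module.Basis.mk (v := basisSection e) ?_ ?_⟩
  · rw [Fintype.linearIndependent_iff]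
    intro g hg i
    have h : coord e (𝟙 W) (∑ j, g j • basisSection e j) i = coord e (𝟙 W) 0 i :=
      congrArg (fun s => coord e (𝟙 W) s i) hg
    rw [coord_def e (𝟙 W) (0 : Γ(E, W)), appLE_zero_right] at h
    have hsum : coord e (𝟙 W) (∑ j, g j • basisSection e j) i = g i := by
      have hlin : ∀ (t : Finset I), coord e (𝟙 W) (∑ j ∈ t, g j • basisSection e j) i =
          ∑ j ∈ t, g j * coord e (𝟙 W) (basisSection e j) i := by
        intro t
        induction t using Finset.induction_on with
        | empty =>
          rw [Finset.sum_empty, Finset.sum_empty, coord_def, appLE_zero_right]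
        | insert a t ha ih => rw [Finset.sum_insert ha, Finset.sum_insert ha, coord_add, coord_smul, ih]
      rw [hlin, Finset.sum_eq_single i]
      · rw [coord_basisSection, if_pos rfl, mul_one]
      · intro j _ hji
        rw [coord_basisSection, if_neg hji, mul_zero]
      · intro hi
        exact absurd (Finset.mem_univ i) hi
    rw [← hsum]
    exact h
  · intro s _
    rw [eq_sum_coord_smul e (𝟙 W) s]
    refine Submodule.sum_mem _ fun i _ => Submodule.smul_mem _ _ (Submodule.subset_span ⟨i, ?_⟩)
    rw [op_id, E.presheaf.map_id]
    rfl

end FrameBasis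

/-! ### A retract of a framed module has finite projective sections -/

section Retract

variable {K E : X.Modules} {V : X.Opens}

/-- If `K|_V` is a retract of `E|_V` and `Γ(E, V)` is free of finite rank, then `Γ(K, V)` is a finite
projective `Γ(X, V)`-module. -/
theorem finite_and_projective_sections_of_retract (ι : K.over V ⟶ E.over V) (ρ : E.over V ⟶ K.over V)
    (h : ι ≫ ρ = 𝟙 _) [Module.Free Γ(X, V) Γ(E, V)] [Module.Finite Γ(X, V) Γ(E, V)] :
    Module.Finite Γ(X, V) Γ(K, V) ∧ Module.Projective Γ(X, V) Γ(K, V) := by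
  let ιL : Γ(K, V) →ₗ[Γ(X, V)] Γ(E, V) :=
    { toFun := fun s => appLE ι (𝟙 V) s
      map_add' := fun s t => appLE_add_right ι (𝟙 V) s t
      map_smul' := fun a s => appLE_smul_right ι (𝟙 V) a s }
  let ρL : Γ(E, V) →ₗ[Γ(X, V)] Γ(K, V) :=
    { toFun := fun s => appLE ρ (𝟙 V) s
      map_add' := fun s t => appLE_add_right ρ (𝟙 V) s t
      map_smul' := fun a s => appLE_smul_right ρ (𝟙 V) a s }
  have hcomp : ρL.comp ιL = LinearMap.id := by
    ext s
    change appLE ρ (𝟙 V) (appLE ι (𝟙 V) s) = s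
    rw [← appLE_comp, h, appLE_id]
  have hsurj : Function.Surjective ρL := fun s => ⟨ιL s, congrArg (fun f => f s) hcomp⟩
  exact ⟨Module.Finite.of_surjective ρL hsurj, Module.Projective.of_split ιL ρL hcomp⟩

end Retract

/-! ### An affine-localizing module with free sections on an affine open is free there -/

section FreeOnAffine

variable (M : X.Modules)

/-- The restriction of an affine-localizing `M` to `Spec Γ(X, V) ⟶ X` (`V` affine) is *localizing* in
Mathlib's sense: its sections over `D(f)` are the localization at `f` of its global sections (the
numerator and torsion properties of `IsAffineLocalizing` on the affine `V = fromSpec(⊤)`; compare the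
tree's `isLocalizing_cotangentSheaf_restrict`). -/
theorem isLocalizing_restrict_fromSpec (hM : IsAffineLocalizing M) {V : X.Opens} (hV : IsAffineOpen V) :
    IsLocalizing (modulesSpecToSheaf.obj (M.restrict hV.fromSpec)) := by
  intro f
  have hle₁ : hV.fromSpec ''ᵁ ⊤ ≤ V := Literature.AlgebraicGeometry.Motives.fromSpec_image_le hV ⊤
  have hW₁ : IsAffineOpen (hV.fromSpec ''ᵁ ⊤) := by rw [fromSpec_image_top hV]; exact hV
  have hW : hV.fromSpec ''ᵁ PrimeSpectrum.basicOpen f =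
      X.basicOpen (X.presheaf.map (homOfLE hle₁).op f) := by
    rw [hV.fromSpec_image_basicOpen, Scheme.basicOpen_res, fromSpec_image_top hV, eq_comm,
      inf_eq_right]
    exact X.basicOpen_le f
  let i : hV.fromSpec ''ᵁ PrimeSpectrum.basicOpen f ⟶ hV.fromSpec ''ᵁ ⊤ :=
    homOfLE (hV.fromSpec.image_mono le_top)
  have hf : X.presheaf.map i.op (X.presheaf.map (homOfLE hle₁).op f) =
      X.presheaf.map (homOfLE (Literature.AlgebraicGeometry.Motives.fromSpec_image_le hV (PrimeSpectrum.basicOpen f))).op f := by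
    rw [← CommRingCat.comp_apply, ← Functor.map_comp, opens_op_hom_ext (_ ≫ _) (homOfLE _).op]
  have hi : i = homOfLE (hW.trans_le (X.basicOpen_le _)) := Subsingleton.elim _ _
  refine IsLocalizedModule.Away.mk_of_addCommGroup ?_ ?_ ?_
  · exact Scheme.Modules.isUnit_algebraMap_end_of_le_basicOpen f le_rfl
  · intro x
    obtain ⟨n, y, h⟩ := hM.numerator hW₁ (X.presheaf.map (homOfLE hle₁).op f) hW x
    refine ⟨n, y, ?_⟩
    change f ^ n • (show Γ(M.restrict hV.fromSpec, PrimeSpectrum.basicOpen f) from x) = _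
    rw [restrict_fromSpec_smul_def, map_pow, ← hf, hi]
    exact h.symm
  · intro y hy
    obtain ⟨n, hn⟩ := hM.torsion hW₁ (X.presheaf.map (homOfLE hle₁).op f) y
      (hW.trans_le (X.basicOpen_le _)) hW.ge (by rw [← hi]; exact hy)
    refine ⟨n, ?_⟩
    change f ^ n • (show Γ(M.restrict hV.fromSpec, ⊤) from y) = 0
    rw [restrict_fromSpec_smul_def, map_pow]
    exact hn

/-- **An affine-localizing module whose sections over an affine open `V` are free on a basis indexed
by `ι` is free on `ι` over `V`**: `free ι ≅ M.over V` (`M|_{Spec Γ(X,V)} ≅ Γ(V, M)~ ≅ (⊕_ι B)~ ≅ 𝒪^ι`,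
then transport to the over-site of `V`, tree `nonempty_free_iso_over_of_free_iso_restrict`). -/
theorem nonempty_free_iso_over_of_basis (hM : IsAffineLocalizing M) {V : X.Opens}
    (hV : IsAffineOpen V) {ι : Type u} (b : Module.Basis ι Γ(X, V) Γ(M, V)) :
    Nonempty (SheafOfModules.free ι ≅ M.over V) := by
  haveI : IsIso (M.restrict hV.fromSpec).fromTildeΓ :=
    (isIso_fromTildeΓ_iff_isLocalizing _).mpr (isLocalizing_restrict_fromSpec M hM hV)
  let N := M.restrict hV.fromSpec
  -- transport the basis to the global sections of the restricted module
  let e : Γ(M, V) ≃ₗ[Γ(X, V)] Γ(N, ⊤) :=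
    { (M.presheaf.mapIso (eqToIso (fromSpec_image_top hV)).op).addCommGroupIsoToAddEquiv with
      map_smul' := fun r x => by
        change M.presheaf.map (eqToHom (fromSpec_image_top hV)).op (r • x) =
          r • (show Γ(N, ⊤) from M.presheaf.map _ x)
        rw [restrict_fromSpec_smul_def, eqToHom_op,
          opens_op_hom_ext (eqToHom _) (homOfLE (Literature.AlgebraicGeometry.Motives.fromSpec_image_le hV ⊤)).op]
        exact M.map_smul (homOfLE (Literature.AlgebraicGeometry.Motives.fromSpec_image_le hV ⊤)) r x }
  let b' : Module.Basis ι Γ(X, V) ((modulesSpecToSheaf.obj N).presheaf.obj (op ⊤)) := b.map e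
  have eN : SheafOfModules.free ι ≅ N :=
    (tildeFinsupp _).symm ≪≫ (tilde.functor _).mapIso b'.repr.toModuleIso.symm ≪≫ asIso N.fromTildeΓ
  exact nonempty_free_iso_over_of_free_iso_restrict hV M eN

end FreeOnAffine

/-! ### Commutative algebra: finite projective modules are free on a basic open neighbourhood -/

section Algebra

/-- **A finite projective module over `B` is free on some `D(r) ∋ 𝔭`** for every prime `𝔭`: `P_𝔭` is
free (Mathlib `Module.free_of_flat_of_isLocalRing`) and the freeness spreads out to some `P_r`,
`r ∉ 𝔭` (Mathlib `Module.FinitePresentation.exists_free_localizedModule_powers`); the basis is finite. -/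
theorem exists_basis_localizedModule_away {B : Type u} [CommRing B] (P : Type u) [AddCommGroup P]
    [Module B P] [Module.Finite B P] [Module.Projective B P] (𝔭 : Ideal B) [𝔭.IsPrime] :
    ∃ r : B, r ∉ 𝔭 ∧ ∃ (ι : Type u) (_ : Finite ι),
      Nonempty (Module.Basis ι (Localization (.powers r)) (LocalizedModule.Away r P)) := by
  haveI : Module.FinitePresentation B P := Module.finitePresentation_of_projective B P
  haveI : Module.Free (Localization.AtPrime 𝔭) (LocalizedModule 𝔭.primeCompl P) :=
    Module.free_of_flat_of_isLocalRing
  obtain ⟨r, hr, hfree, -⟩ := Module.FinitePresentation.exists_free_localizedModule_powers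
    𝔭.primeCompl (LocalizedModule.mkLinearMap 𝔭.primeCompl P) (Localization.AtPrime 𝔭)
  haveI := hfree
  exact ⟨r, hr, Module.Free.ChooseBasisIndex (Localization (.powers r)) (LocalizedModule.Away r P),
    inferInstance, ⟨Module.Free.chooseBasis _ _⟩⟩

end Algebra

/-! ### Sections of an affine-localizing module over a basic open of an affine open -/

section BasicOpen

variable {K : X.Modules} (hK : IsAffineLocalizing K) {V : X.Opens} (hV : IsAffineOpen V) (r : Γ(X, V))

include hK hV in
/-- **`Γ(K, D(r)) = Γ(K, V)_r` for an affine-localizing `K` and an affine `V`**, in the form: a basis of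
the localized module `Γ(K, V)_r` over `Γ(X, V)_r` yields a basis of `Γ(K, D(r))` over `Γ(X, D(r))`
(numerators/torsion of `IsAffineLocalizing`, Mathlib `IsLocalizedModule.Away.mk_of_addCommGroup`,
`IsLocalizedModule.isBaseChange`, `IsAffineOpen.isLocalization_basicOpen`). -/
theorem nonempty_basis_sections_basicOpen {ι : Type u}
    (b : Module.Basis ι (Localization (.powers r)) (LocalizedModule.Away r Γ(K, V))) :
    Nonempty (Module.Basis ι Γ(X, X.basicOpen r) Γ(K, X.basicOpen r)) := by
  -- notation: `B = Γ(X, V)`, `A = Γ(X, D(r)) = B_r`, `L = Localization`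
  haveI : IsLocalization.Away r Γ(X, X.basicOpen r) := hV.isLocalization_basicOpen r
  letI : Module Γ(X, V) Γ(K, X.basicOpen r) :=
    Module.compHom _ (algebraMap Γ(X, V) Γ(X, X.basicOpen r))
  haveI : IsScalarTower Γ(X, V) Γ(X, X.basicOpen r) Γ(K, X.basicOpen r) :=
    IsScalarTower.of_algebraMap_smul fun _ _ => rfl
  -- the restriction map, `Γ(X, V)`-linear
  let res : Γ(K, V) →ₗ[Γ(X, V)] Γ(K, X.basicOpen r) :=
    { toFun := K.presheaf.map (homOfLE (X.basicOpen_le r)).op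
      map_add' := fun a c => map_add _ a c
      map_smul' := fun a m => K.map_smul (homOfLE (X.basicOpen_le r)) a m }
  -- it is a localization at `r`
  haveI hloc : IsLocalizedModule.Away r res := by
    refine IsLocalizedModule.Away.mk_of_addCommGroup ?_ ?_ ?_
    · rw [Module.End.isUnit_iff]
      have : ⇑(algebraMap Γ(X, V) (Module.End Γ(X, V) Γ(K, X.basicOpen r)) r) =
          algebraMap Γ(X, X.basicOpen r) (Module.End Γ(X, X.basicOpen r) Γ(K, X.basicOpen r))
            (algebraMap Γ(X, V) Γ(X, X.basicOpen r) r) := rfl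
      rw [this, ← Module.End.isUnit_iff]
      exact (IsLocalization.Away.algebraMap_isUnit r).map _
    · intro x
      obtain ⟨n, y, h⟩ := hK.numerator hV r (W := X.basicOpen r) rfl x
      refine ⟨n, y, ?_⟩
      change (algebraMap Γ(X, V) Γ(X, X.basicOpen r) (r ^ n)) • x = K.presheaf.map _ y
      rw [map_pow]
      exact h.symm
    · intro y hy
      exact hK.torsion hV r y (X.basicOpen_le r) le_rfl hy
  have hbc : IsBaseChange Γ(X, X.basicOpen r) res :=
    IsLocalizedModule.isBaseChange (.powers r) Γ(X, X.basicOpen r) res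
  -- transport the basis: `P_r ≃ L ⊗ P`, base change along `L ≃ A`, `A ⊗_L (L ⊗ P) ≃ A ⊗ P ≃ Γ(K, D(r))`
  let e₁ := (IsLocalizedModule.isBaseChange (.powers r) (Localization (.powers r))
    (LocalizedModule.mkLinearMap (.powers r) Γ(K, V))).equiv
  let b₁ : Module.Basis ι (Localization (.powers r)) (TensorProduct Γ(X, V) (Localization (.powers r))
    Γ(K, V)) := b.map e₁.symm
  let g : Localization (.powers r) ≃ₐ[Γ(X, V)] Γ(X, X.basicOpen r) :=
    IsLocalization.algEquiv (.powers r) _ _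
  letI : Algebra (Localization (.powers r)) Γ(X, X.basicOpen r) := g.toRingHom.toAlgebra
  haveI : IsScalarTower Γ(X, V) (Localization (.powers r)) Γ(X, X.basicOpen r) :=
    IsScalarTower.of_algebraMap_eq fun x => (g.commutes x).symm
  let b₂ := Algebra.TensorProduct.basis Γ(X, X.basicOpen r) b₁
  let e₂ := TensorProduct.AlgebraTensorModule.cancelBaseChange Γ(X, V) (Localization (.powers r))
    Γ(X, X.basicOpen r) Γ(X, X.basicOpen r) Γ(K, V)
  exact ⟨(b₂.map e₂).map hbc.equiv⟩

include hV in
/-- A point of the affine open `V` lies in `D(r)` iff `r` is not in its prime ideal. -/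
theorem mem_basicOpen_iff_not_mem_primeIdealOf {x : X} (hx : x ∈ V) :
    x ∈ X.basicOpen r ↔ r ∉ (hV.primeIdealOf ⟨x, hx⟩).asIdeal := by
  have hp : hV.fromSpec (hV.primeIdealOf ⟨x, hx⟩) = x := hV.fromSpec_primeIdealOf ⟨x, hx⟩
  rw [← PrimeSpectrum.mem_basicOpen (R := Γ(X, V)), ← hV.fromSpec_preimage_basicOpen r]
  conv_lhs => rw [← hp]
  rfl

end BasicOpen

/-! ### The theorem -/

section Kernel

variable {E F : X.Modules} (φ : E ⟶ F) [Epi φ]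

/-- **The kernel of an epimorphism of finite locally free `𝒪_X`-modules is finite locally free**
(Stacks 05P2 / 00NX). -/
theorem isFiniteLocallyFree_kernel (hE : IsFiniteLocallyFree E) (hF : IsFiniteLocallyFree F) :
    IsFiniteLocallyFree (kernel φ) := by
  classical
  intro x
  -- the short exact sequence `0 → K → E → F → 0` and a local splitting near `x`
  have hS : (ShortComplex.mk (kernel.ι φ) φ (kernel.condition φ)).ShortExact :=
    ShortComplex.ShortExact.mk' (ShortComplex.exact_of_f_is_kernel _ (kernelIsKernel φ))
      inferInstance inferInstance
  obtain ⟨W, hxW, hsplit⟩ := exists_isSplitMono_over_of_shortExact hS hF x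
  obtain ⟨sm⟩ := hsplit.exists_splitMono
  -- a frame of `E` near `x`, and an affine open `V ∋ x` inside both
  obtain ⟨U, hxU, I, hI, ⟨eE⟩⟩ := hE x
  obtain ⟨V, hV, hxV, hVle⟩ := Opens.isBasis_iff_nbhd.mp X.isBasis_affineOpens
    (show x ∈ W ⊓ U from ⟨hxW, hxU⟩)
  have hVW : V ≤ W := hVle.trans inf_le_left
  have hVU : V ≤ U := hVle.trans inf_le_right
  -- `K|_V` is a retract of `E|_V ≅ 𝒪^I`
  let ιV : (kernel φ).over V ⟶ E.over V := (Scheme.Modules.overFunctor V).map (kernel.ι φ)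
  let ρV : E.over V ⟶ (kernel φ).over V := restrictHom (homOfLE hVW) sm.retraction
  have hret : ιV ≫ ρV = 𝟙 _ := by
    have h1 : ιV = restrictHom (homOfLE hVW) ((Scheme.Modules.overFunctor W).map (kernel.ι φ)) :=
      (restrictHom_over_map (homOfLE hVW) (kernel.ι φ)).symm
    rw [h1, ← restrictHom_comp, sm.id]
    exact restrictHom_id _
  let eV : SheafOfModules.free I ≅ E.over V :=
    SheafOfModules.restrictTrivialisation (R := X.ringCatSheaf) (homOfLE hVU) eE
  haveI := Fintype.ofFinite I
  obtain ⟨bE⟩ := nonempty_basis_of_frame eV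
  haveI : Module.Free Γ(X, V) Γ(E, V) := Module.Free.of_basis bE
  haveI : Module.Finite Γ(X, V) Γ(E, V) := Module.Finite.of_basis bE
  obtain ⟨hfin, hproj⟩ := finite_and_projective_sections_of_retract ιV ρV hret
  haveI := hfin
  haveI := hproj
  -- the prime of `x` in `B = Γ(X, V)` and a basic open `D(r) ∋ x` on which `Γ(K, V)_r` is free
  obtain ⟨r, hr, ι', hι', ⟨b⟩⟩ :=
    exists_basis_localizedModule_away Γ(kernel φ, V) (hV.primeIdealOf ⟨x, hxV⟩).asIdeal
  have hxD : x ∈ X.basicOpen r := (mem_basicOpen_iff_not_mem_primeIdealOf hV r hxV).mpr hr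
  -- `K` is affine-localizing (kernel of quasi-coherent modules)
  haveI := hE.isVectorBundle.1
  haveI := hF.isVectorBundle.1
  have hK : IsAffineLocalizing (kernel φ) :=
    IsAffineLocalizing.kernel φ (IsAffineLocalizing.of_isQuasicoherent E)
      (IsAffineLocalizing.of_isQuasicoherent F)
  obtain ⟨bD⟩ := nonempty_basis_sections_basicOpen hK hV r b
  obtain ⟨iso⟩ := nonempty_free_iso_over_of_basis (kernel φ) hK (hV.basicOpen r) bD
  exact ⟨X.basicOpen r, hxD, ι', hι', ⟨iso⟩⟩

end Kernel

/-- **Registered sub-goal** (helper stub of `stub_towerPresentation`, universe `0`): the kernel of an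
epimorphism between finite locally free modules is finite locally free (`isFiniteLocallyFree_kernel`). -/
theorem stub_kernelVectorBundle :
    ∀ (X : AlgebraicGeometry.Scheme.{0}) (E F : X.Modules) (φ : E ⟶ F) [CategoryTheory.Epi φ],
      Literature.AlgebraicGeometry.Motives.IsFiniteLocallyFree E →
      Literature.AlgebraicGeometry.Motives.IsFiniteLocallyFree F →
        Literature.AlgebraicGeometry.Motives.IsFiniteLocallyFree (CategoryTheory.Limits.kernel φ) :=
  fun _ _ _ φ _ hE hF => isFiniteLocallyFree_kernel φ hE hF

end Summit.HodgeConjecture.HodgeConjecture.Theorems.FormalVectorBundlesAlgebraize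

end
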